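import Literature.Barriers.CriticalPhenomena.SupercriticalSAWSpaceFillingSubcritical
import Literature.Barriers.CriticalPhenomena.SupercriticalSAWSpaceFillingProofsOnto
import HarnessLib

/-!
# Barrier mechanism, sixth audit (part B): supercritical walks are LONG, the length is
# stochastically increasing in the fugacity, and a `μ`-free TUNED fugacity sequence converges
# to `x_c` — the length axis of the barrier, and evasion (xi) made rigorous

Barrier catalogue `Literature/Barriers/CriticalPhenomena/` (D-0021); companion of
`SupercriticalSAWSpaceFillingPhases` (sixth audit, 2026-08-16, refuter, "barrier-audit" gen 6,
of the mechanism file `…Proofs` of `SupercriticalSAWSpaceFilling` = Theorem 1 of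
H. Duminil-Copin, G. Kozma, A. Yadin, *Supercritical self-avoiding walks are space-filling*,
Ann. IHP Probab. Stat. 50 (2014) 315–326, arXiv:1110.3074, PROVED in the tree). Part A
(`…Phases`) completed the curve-topology axis (the `(x, κ)` phase constraint) and recorded two
unobstructed readings for planners: (x) the sub-problem is existential in the fugacity, and (xi)
DATA-DRIVEN tuned fugacities `x_δ` fixed by a balance condition at mesh `δ`. This file makes
(xi) rigorous for the LENGTH balance and, on the way, machine-checks the length side of the
source's phase picture.

## What is proved

1. **Supercritical walks are long** (`tendsto_lawAt_length_mul_lt_of_lt`): for `x > x_c`,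
   boundary points `a ≠ b` of `𝔻` and closest-site endpoints there is `κ₀ = κ₀(x) > 0` with
   `P_{(𝔻_δ,a_δ,b_δ,x)}[(|γ_δ| + 1) δ² log²(1/δ) < κ₀] → 0`: the walk has at least
   `κ₀ δ⁻²/log²(1/δ)` vertices with probability `→ 1`. The source, §4: "It is not difficult to
   show that the length is of order `1/δ²`" (before Problem 9, which asks for a density
   `θ(x)`); here the logarithm of Theorem 1 is kept. Proof: on the complement of the event of
   Theorem 1 (`DKY2014_thm1_holds`: no component of `𝔻_δ ∖ Γ_δ^ξ` exceeds `c log(1/δ)` sites)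
   every ball `B(z, r) ⊆ 𝔻` of radius `r = (8 + 2ξ + 8c) δ log(1/δ)` contains a visited mesh point
   (`hasLargeHole_of_forall_notMem_ball` of `…Refutation`, contraposed), and the `⌊1/(4r)⌋²`
   grid balls `B(z_{k,l}, r)`, `z_{k,l} = (2rk - 1/4) + (2rl - 1/4)i`, are pairwise disjoint
   inside `𝔻`, so the walk has `≥ ⌊1/(4r)⌋² ≥ 1/(64 r²)` vertices
   (`sq_le_length_succ_of_forall_exists`, `gridSize_sq_le_of_not_hasLargeHole`).
2. **The length axis of the barrier.** With the subcritical bound of `…SubcriticalLength`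
   (`|γ_δ| ≤ C(x)/δ` w.h.p. for `x < x_c`) this is a length TRICHOTOMY around the predicted
   critical scale `|γ_δ| ≍ δ^{-1/ν} = δ^{-4/3}` ("the dimension of the paths of the scaling limit
   of SAWs should be `1/ν`", `ν = 3/4` [LSW04, §1 and Prediction 2]): any fugacity-robust
   conclusion about the LENGTH or natural-parametrisation exponent — "`|γ_δ| = δ^{-4/3+o(1)}`",
   a `δ^{4/3}`-normalised occupation measure with a non-trivial limit, a Minkowski-content
   parametrisation of dimension `4/3` — fails at EVERY `x ≠ x_c` (`O(1/δ)` below,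
   `≥ κ₀ δ⁻²/log²` above), by counting alone, with no curve topology involved
   (`tendsto_lawAt_not_lt_length_of_lt`, `tendsto_lawAt_lt_length_of_lt_criticalFugacity` for any
   threshold `L(δ)` with `δ L(δ) → ∞`, `(L(δ)+1) δ² log²(1/δ) → 0`).
3. **The length is stochastically increasing in the fugacity** (`lawAt_setOf_lt_length_mono`):
   for `0 < x ≤ y` and every `L`, `P_x[|γ| > L] ≤ P_y[|γ| > L]` — the family `x^{|γ|}` has
   monotone likelihood ratio in `|γ|`; the proof is the finite double sum
   `Σ_{|γ|>L, |γ'|≤L} (x^{|γ|} y^{|γ'|} - y^{|γ|} x^{|γ'|}) ≤ 0` (`sum_mul_sum_le_of_forall_le`) on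
   the representation `P_x(E) = Σ_{γ∈E} x^{|γ|} / Σ_γ x^{|γ|}` (`lawAt_apply_eq_ofReal_div`;
   `isProbabilityMeasure_lawAt`).
4. **Tuned fugacities exist and converge to `x_c` — with no knowledge of `μ(ℤ²)`.** For a
   threshold `L(δ)` between the phases and `t ∈ (0, 1)`: (`exists_tuned`) for all small `δ` there
   is `x_δ ∈ (0, x_c + 1]` with `P_{(𝔻_δ,a_δ,b_δ,x_δ)}[|γ_δ| > L(δ)] = t` EXACTLY — the
   probability is a continuous function of the fugacity (ratio of polynomials), `≤ #SAW · x` for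
   `x ≤ 1` once `L(δ) ≥ 4/δ`, and `> t` at `x_c + 1` by item 1: intermediate value theorem; and
   (`tendsto_criticalFugacity_of_tuned`) EVERY family `x_δ > 0` so tuned satisfies `x_δ → x_c`,
   by item 3: it cannot stay `≥ x_c + ε` (there the probability tends to `1`) nor `≤ x_c - ε`
   (there it tends to `0`). The instance `L(δ) = δ^{-4/3}`, `t = 1/2`, `(𝔻; 1, -1)`:
   `exists_tuned_unitDisc`, `tendsto_criticalFugacity_of_tuned_unitDisc`, assembled by choice in
   `exists_tuned_tendsto_unitDisc` (`admissible_rpow_neg_four_thirds`). So evasion (xi) of the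
   catalogue is realised: a canonical sequence of fugacities converging to `1/μ(ℤ²)` along which
   the walk is pinned at the critical length scale with probability `1/2` — defined without the
   value of `μ`, hence outside the technique class "conclusions at a fixed `x ≠ x_c`", and not
   equivalent to the critical law by anything in the tree (whether `x_δ - x_c = o(δ²)`, the
   window of `…Narrow`, is open; so is every property of the limit laws along `x_δ`).

## What this does NOT give (scope)

The tuned condition pins one quantile of the length; it excludes neither thin nor onto
subsequential limits along `x_δ` (`P[|γ_δ| ≤ δ^{-4/3}] = 1/2` allows half the mass on short
walks and half on dense ones), and a single real parameter cannot be tuned to two balance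
conditions. An AVOIDANCE balance (`P_{x_δ}[γ_δ ∩ U = ∅] = 1/2`, part A (xi)) would force
non-onto limits but lacks the monotonicity in `x` used here, so `x_δ → x_c` is not proved for
it. The supercritical length bound is for the closest-site endpoints of boundary points of the
unit disc (the setting of Theorem 1); the density `θ(x)` of Problem 9 is untouched.

## Formal content (all proved; one new closed `Prop`, `SupercriticalSAWSpaceFillingTuned`)

Grid: `gridCenter`, `gridSize`, `abs_coord_le`, `ball_gridCenter_subset`,
`two_mul_le_norm_gridCenter_sub`, `eq_of_mem_ball_gridCenter`; counting:
`sq_le_length_succ_of_forall_exists`, `exists_mem_ball_of_not_hasLargeHole`,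
`gridSize_sq_le_of_not_hasLargeHole`; long walks: `tendsto_mul_log_one_div_nhdsGT`,
`one_le_log_one_div`, `tendsto_lawAt_length_mul_lt_of_lt`; ratio and monotonicity:
`sum_mul_sum_le_of_forall_le`, `div_add_le_div_add`, `sum_pow_length_pos`,
`lawAt_apply_eq_ofReal_div`, `isProbabilityMeasure_lawAt`, `lawAt_setOf_lt_length_mono`; tuned
sequences: `tendsto_lawAt_not_lt_length_of_lt`, `tendsto_lawAt_lt_length_of_lt_criticalFugacity`,
`tendsto_criticalFugacity_of_tuned`, `exists_tuned`, `admissible_rpow_neg_four_thirds`,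
`exists_tuned_unitDisc`, `tendsto_criticalFugacity_of_tuned_unitDisc`,
`exists_tuned_tendsto_unitDisc`; the closed `Prop`
`SupercriticalSAWSpaceFillingTuned` and `SupercriticalSAWSpaceFillingTuned_holds`.

Mathlib: `Finset.card_le_card_of_injOn`, `List.toFinset_card_le`, `SimpleGraph.Walk.length_support`,
`Nat.sub_one_lt_floor`, `Nat.lt_floor_add_one`, `tendsto_log_mul_rpow_nhdsGT_zero`,
`tendsto_rpow_neg_nhdsGT_zero`, `Finset.sum_mul_sum`, `Finset.sum_filter_add_sum_filter_not`,
`div_le_div_iff₀`, `ENNReal.ofReal_div_of_pos`, `MeasureTheory.probReal_compl_eq_one_sub`,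
`intermediate_value_Icc`, `continuous_finsetSum`, `pow_le_pow_of_le_one`.

## References (page-level; pages of the arXiv versions)

* H. Duminil-Copin, G. Kozma, A. Yadin, Ann. IHP Probab. Stat. 50 (2014) 315–326,
  arXiv:1110.3074: p. 2 (§1: the three phases; Theorem 1), p. 8 (§4: "It is not difficult to
  show that the length is of order `1/δ²`"; Problem 9). [DuminilCopinKozmaYadin2014]
* G. F. Lawler, O. Schramm, W. Werner, *On the scaling limit of planar self-avoiding walk* (2004),
  arXiv:math/0204277: p. 3, §1 ("Flory was the first to conjecture `ν = 3/4`"), p. 17,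
  Prediction 2 ("the dimension of the paths of the scaling limit of SAWs should be `1/ν`";
  `ν = 3/4`). [LawlerSchrammWerner2004SAW]
* N. Madras, G. Slade, *The Self-Avoiding Walk* (1993), §1.2 — the subcritical input, through
  `…SubcriticalLength`. [MadrasSlade1993]
-/

noncomputable section

open MeasureTheory Filter Topology Metric Set Literature.Probability.LatticeModels
  Literature.Probability.Percolation Literature.Probability.RandomPlanarGeometry
  Literature.Probability.RandomPlanarGeometry.SAW
open scoped ENNReal NNReal

namespace Literature.Barriers.CriticalPhenomena

namespace SupercriticalSAW

/-! ### A grid of disjoint balls in the disc -/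

section Grid

/-- The grid point `(2rk - 1/4) + (2rl - 1/4) i`. [folklore] -/
def gridCenter (r : ℝ) (k l : ℕ) : ℂ :=
  ((2 * r * k - 1 / 4 : ℝ) : ℂ) + ((2 * r * l - 1 / 4 : ℝ) : ℂ) * Complex.I

/-- Real part of a grid point. [folklore] -/
theorem gridCenter_re (r : ℝ) (k l : ℕ) : (gridCenter r k l).re = 2 * r * k - 1 / 4 := by
  simp [gridCenter]

/-- Imaginary part of a grid point. [folklore] -/
theorem gridCenter_im (r : ℝ) (k l : ℕ) : (gridCenter r k l).im = 2 * r * l - 1 / 4 := by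
  simp [gridCenter]

/-- The number of grid points per row: `M = ⌊1/(4r)⌋`. [folklore] -/
def gridSize (r : ℝ) : ℕ := ⌊1 / (4 * r)⌋₊

/-- For `k < M` the coordinate `2rk - 1/4` lies in `[-1/4, 1/4]`. [folklore] -/
theorem abs_coord_le {r : ℝ} (hr : 0 < r) {k : ℕ} (hk : k < gridSize r) :
    |2 * r * k - 1 / 4| ≤ 1 / 4 := by
  have h1 : (k : ℝ) ≤ 1 / (4 * r) := by
    have : (k : ℝ) ≤ (gridSize r : ℝ) := by exact_mod_cast hk.le
    exact this.trans (Nat.floor_le (by positivity))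
  have h2 : 2 * r * k ≤ 1 / 2 := by
    calc 2 * r * k ≤ 2 * r * (1 / (4 * r)) := by gcongr
      _ = 1 / 2 := by field_simp; ring
  have h3 : (0 : ℝ) ≤ 2 * r * k := by positivity
  rw [abs_le]; constructor <;> linarith

/-- Grid balls of radius `r ≤ 1/2` with indices `< M` lie in the unit disc. [folklore] -/
theorem ball_gridCenter_subset {r : ℝ} (hr : 0 < r) (hr2 : r < 1 / 2) {k l : ℕ}
    (hk : k < gridSize r) (hl : l < gridSize r) : ball (gridCenter r k l) r ⊆ unitDisk := by
  intro p hp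
  rw [unitDisk, mem_ball_zero_iff]
  have hz : ‖gridCenter r k l‖ ≤ 1 / 2 := by
    refine (Complex.norm_le_abs_re_add_abs_im _).trans ?_
    rw [gridCenter_re, gridCenter_im]
    have := abs_coord_le hr hk
    have := abs_coord_le hr hl
    linarith
  calc ‖p‖ = ‖(p - gridCenter r k l) + gridCenter r k l‖ := by rw [sub_add_cancel]
    _ ≤ ‖p - gridCenter r k l‖ + ‖gridCenter r k l‖ := norm_add_le _ _
    _ < r + 1 / 2 := by
        have h := mem_ball_iff_norm.1 hp
        linarith
    _ < 1 := by linarith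

/-- Distinct grid points are `2r` apart. [folklore] -/
theorem two_mul_le_norm_gridCenter_sub {r : ℝ} (hr : 0 < r) {k l k' l' : ℕ}
    (h : (k, l) ≠ (k', l')) : 2 * r ≤ ‖gridCenter r k l - gridCenter r k' l'‖ := by
  have hre : (gridCenter r k l - gridCenter r k' l').re = 2 * r * ((k : ℝ) - k') := by
    rw [Complex.sub_re, gridCenter_re, gridCenter_re]; ring
  have him : (gridCenter r k l - gridCenter r k' l').im = 2 * r * ((l : ℝ) - l') := by
    rw [Complex.sub_im, gridCenter_im, gridCenter_im]; ring
  by_cases hk : k = k'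
  · subst hk
    have hl : l ≠ l' := fun hl => h (by rw [hl])
    have h1 : (1 : ℝ) ≤ |(l : ℝ) - l'| := by
      rcases lt_or_gt_of_ne hl with hlt | hlt
      · have h' : (l : ℝ) + 1 ≤ l' := by exact_mod_cast hlt
        rw [abs_of_neg (by linarith)]
        linarith
      · have h' : (l' : ℝ) + 1 ≤ l := by exact_mod_cast hlt
        rw [abs_of_pos (by linarith)]
        linarith
    calc 2 * r ≤ 2 * r * |(l : ℝ) - l'| := le_mul_of_one_le_right (by positivity) h1
      _ = |(gridCenter r k l - gridCenter r k l').im| := by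
          rw [him, abs_mul, abs_of_pos (by positivity : (0 : ℝ) < 2 * r)]
      _ ≤ ‖gridCenter r k l - gridCenter r k l'‖ := Complex.abs_im_le_norm _
  · have h1 : (1 : ℝ) ≤ |(k : ℝ) - k'| := by
      rcases lt_or_gt_of_ne hk with hlt | hlt
      · have h' : (k : ℝ) + 1 ≤ k' := by exact_mod_cast hlt
        rw [abs_of_neg (by linarith)]
        linarith
      · have h' : (k' : ℝ) + 1 ≤ k := by exact_mod_cast hlt
        rw [abs_of_pos (by linarith)]
        linarith
    calc 2 * r ≤ 2 * r * |(k : ℝ) - k'| := le_mul_of_one_le_right (by positivity) h1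
      _ = |(gridCenter r k l - gridCenter r k' l').re| := by
          rw [hre, abs_mul, abs_of_pos (by positivity : (0 : ℝ) < 2 * r)]
      _ ≤ ‖gridCenter r k l - gridCenter r k' l'‖ := Complex.abs_re_le_norm _

/-- Distinct grid balls are disjoint. [folklore] -/
theorem eq_of_mem_ball_gridCenter {r : ℝ} (hr : 0 < r) {k l k' l' : ℕ} {p : ℂ}
    (h : p ∈ ball (gridCenter r k l) r) (h' : p ∈ ball (gridCenter r k' l') r) :
    (k, l) = (k', l') := by
  by_contra hne
  have h2 := two_mul_le_norm_gridCenter_sub hr hne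
  rw [mem_ball_iff_norm] at h h'
  have := norm_sub_le_norm_sub_add_norm_sub (gridCenter r k l) p (gridCenter r k' l')
  rw [norm_sub_rev (gridCenter r k l) p] at this
  linarith

end Grid

/-! ### A walk meeting every grid ball has many vertices -/

section Count

variable {δ : ℝ} {a b : Site 2}

/-- **Many visited balls force many vertices.** If a SAW of `𝔻_δ` has a vertex with mesh point
in each of the `M²` grid balls `B(z_{k,l}, r)`, `k, l < M` (pairwise disjoint), then it has at
least `M²` vertices: `M² ≤ |γ| + 1`. [folklore] -/
theorem sq_le_length_succ_of_forall_exists {r : ℝ} (hr : 0 < r) (γ : DomainSAW unitDisk δ a b)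
    {M : ℕ}
    (hvis : ∀ k < M, ∀ l < M, ∃ v ∈ γ.walk.support, meshPoint δ v ∈ ball (gridCenter r k l) r) :
    M ^ 2 ≤ γ.length + 1 := by
  classical
  -- a vertex in each ball
  choose! f hf using hvis
  set g : Fin M × Fin M → Site 2 := fun p => f p.1 p.2 with hg
  have hmem : ∀ p : Fin M × Fin M, g p ∈ γ.walk.support.toFinset := fun p => by
    rw [List.mem_toFinset]
    exact (hf p.1 p.1.isLt p.2 p.2.isLt).1
  have hinj : Function.Injective g := by
    rintro ⟨k, l⟩ ⟨k', l'⟩ hkl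
    have h1 := (hf k k.isLt l l.isLt).2
    have h2 := (hf k' k'.isLt l' l'.isLt).2
    change meshPoint δ (g (k, l)) ∈ _ at h1
    change meshPoint δ (g (k', l')) ∈ _ at h2
    rw [hkl] at h1
    have := eq_of_mem_ball_gridCenter hr h1 h2
    simp only [Prod.mk.injEq] at this
    exact Prod.ext (Fin.ext this.1) (Fin.ext this.2)
  have hcard : (Finset.univ : Finset (Fin M × Fin M)).card ≤ γ.walk.support.toFinset.card :=
    Finset.card_le_card_of_injOn g (fun p _ => hmem p) (hinj.injOn)
  rw [Finset.card_univ, Fintype.card_prod, Fintype.card_fin] at hcard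
  have hlen : γ.walk.support.toFinset.card ≤ γ.walk.support.length := List.toFinset_card_le _
  rw [SimpleGraph.Walk.length_support] at hlen
  calc M ^ 2 = M * M := sq M
    _ ≤ γ.length + 1 := hcard.trans hlen

/-- **No large hole forces a vertex in every admissible ball** (contrapositive of
`hasLargeHole_of_forall_notMem_ball`). [cite: DuminilCopinKozmaYadin2014, Theorem 1] -/
theorem exists_mem_ball_of_not_hasLargeHole {ξ r s : ℝ} {z : ℂ} (hδ : 0 < δ)
    (hball : ball z r ⊆ unitDisk) (hδr : 8 * δ ≤ r) (hξ : δ * ξ ≤ r / 2)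
    (ha : a ∈ meshDomain unitDisk δ) (hs : s < (⌊r / (4 * δ)⌋₊ : ℝ) + 1)
    (γ : DomainSAW unitDisk δ a b) (hγ : ¬ HasLargeHole ξ s γ) :
    ∃ v ∈ γ.walk.support, meshPoint δ v ∈ ball z r := by
  by_contra h
  exact hγ (hasLargeHole_of_forall_notMem_ball hδ hball hδr hξ ha hs γ fun v hv hvz => h ⟨v, hv, hvz⟩)

/-- **No large hole forces `⌊1/(4r)⌋² ≤ |γ| + 1`** for every admissible radius `r < 1/2`.
[cite: DuminilCopinKozmaYadin2014, Theorem 1 and §4] -/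
theorem gridSize_sq_le_of_not_hasLargeHole {ξ r s : ℝ} (hδ : 0 < δ) (hr : 0 < r) (hr2 : r < 1 / 2)
    (hδr : 8 * δ ≤ r) (hξ : δ * ξ ≤ r / 2) (ha : a ∈ meshDomain unitDisk δ)
    (hs : s < (⌊r / (4 * δ)⌋₊ : ℝ) + 1) (γ : DomainSAW unitDisk δ a b) (hγ : ¬ HasLargeHole ξ s γ) :
    gridSize r ^ 2 ≤ γ.length + 1 :=
  sq_le_length_succ_of_forall_exists hr γ fun _ hk _ hl =>
    exists_mem_ball_of_not_hasLargeHole hδ (ball_gridCenter_subset hr hr2 hk hl) hδr hξ ha hs γ hγ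

end Count

/-! ### Supercritical walks are long -/

section Long

/-- `δ log(1/δ) → 0` as `δ → 0⁺`. [folklore] -/
theorem tendsto_mul_log_one_div_nhdsGT :
    Tendsto (fun δ : ℝ => δ * Real.log (1 / δ)) (𝓝[>] 0) (𝓝 0) := by
  have h := (tendsto_log_mul_rpow_nhdsGT_zero zero_lt_one).neg
  rw [neg_zero] at h
  refine h.congr' ?_
  filter_upwards [self_mem_nhdsWithin] with δ hδ
  rw [Real.rpow_one, one_div, Real.log_inv]
  ring

/-- For `0 < δ < e⁻¹`, `log(1/δ) ≥ 1`. [folklore] -/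
theorem one_le_log_one_div {δ : ℝ} (hδ0 : 0 < δ) (hδ1 : δ < Real.exp (-1)) :
    1 ≤ Real.log (1 / δ) := by
  have h := Real.log_lt_log hδ0 hδ1
  rw [Real.log_exp] at h
  rw [one_div, Real.log_inv]
  linarith

variable {A B : ℝ → Site 2}

/-- **Supercritical self-avoiding walks are long**: for `x > x_c`, boundary points `a ≠ b` of
`𝔻` and closest-site endpoints, there is `κ₀ = κ₀(x) > 0` with
`P_{(𝔻_δ,a_δ,b_δ,x)}[(|γ_δ| + 1) δ² log²(1/δ) < κ₀] → 0` as `δ → 0⁺` — the walk has at least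
`κ₀ δ⁻² / log²(1/δ)` vertices with probability `→ 1` ("It is not difficult to show that the
length is of order `1/δ²`", §4 of the source; here up to the logarithm of Theorem 1). Proof: on
the complement of the event of Theorem 1 (no component of `𝔻_δ ∖ Γ_δ^ξ` with more than
`c log(1/δ)` sites) every ball of radius `r = (8 + 2ξ + 8c) δ log(1/δ)` inside `𝔻` contains a
visited mesh point (`hasLargeHole_of_forall_notMem_ball`), and `⌊1/(4r)⌋² ≥ 1/(64r²)` such
balls are pairwise disjoint. [cite: DuminilCopinKozmaYadin2014, Theorem 1 and §4 (Problem 9)] -/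
theorem tendsto_lawAt_length_mul_lt_of_lt {x : ℝ} (hx : criticalFugacity < x) {a b : ℂ}
    (ha : ‖a‖ = 1) (hb : ‖b‖ = 1) (hab : a ≠ b)
    (hAB : ∀ δ : ℝ, 0 < δ → IsClosestSite unitDisk δ a (A δ) ∧ IsClosestSite unitDisk δ b (B δ)) :
    ∃ κ₀ : ℝ, 0 < κ₀ ∧
      Tendsto (fun δ : ℝ => lawAt x unitDisk δ (A δ) (B δ)
        {γ | ((γ.length : ℝ) + 1) * (δ ^ 2 * Real.log (1 / δ) ^ 2) < κ₀}) (𝓝[>] 0) (𝓝 0) := by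
  obtain ⟨ξ, hξ, c, hc, hT⟩ := DKY2014_thm1_holds a b ha hb hab x hx
  have hT := hT A B hAB
  set K : ℝ := 8 + 2 * ξ + 8 * c with hK
  have hK0 : 0 < K := by positivity
  refine ⟨1 / (64 * K ^ 2), by positivity, ?_⟩
  have hev1 : ∀ᶠ δ in 𝓝[>] (0 : ℝ), δ ∈ Ioo 0 (Real.exp (-1)) := Ioo_mem_nhdsGT (Real.exp_pos _)
  have hev2 : ∀ᶠ δ in 𝓝[>] (0 : ℝ), K * (δ * Real.log (1 / δ)) < 1 / 8 := by
    have h := tendsto_mul_log_one_div_nhdsGT.const_mul K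
    rw [mul_zero] at h
    exact h.eventually (Iio_mem_nhds (by norm_num))
  have hev : ∀ᶠ δ in 𝓝[>] (0 : ℝ),
      lawAt x unitDisk δ (A δ) (B δ)
          {γ | ((γ.length : ℝ) + 1) * (δ ^ 2 * Real.log (1 / δ) ^ 2) < 1 / (64 * K ^ 2)} ≤
        lawAt x unitDisk δ (A δ) (B δ) {γ | HasLargeHole ξ (c * Real.log (1 / δ)) γ} := by
    filter_upwards [hev1, hev2] with δ hδ hδK
    have hδ0 : 0 < δ := hδ.1
    have hL1 : 1 ≤ Real.log (1 / δ) := one_le_log_one_div hδ0 hδ.2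
    set L : ℝ := Real.log (1 / δ) with hL
    have hL0 : 0 < L := by linarith
    set r : ℝ := K * δ * L with hr
    have hr0 : 0 < r := by positivity
    have hr8 : r ≤ 1 / 8 := by rw [hr, mul_assoc]; exact hδK.le
    have hr2 : r < 1 / 2 := by linarith
    have h8K : 8 ≤ K := by rw [hK]; nlinarith
    have hδr : 8 * δ ≤ r :=
      calc 8 * δ = 8 * δ * 1 := by ring
        _ ≤ 8 * δ * L := by gcongr
        _ ≤ K * δ * L := by gcongr
    have hξr : δ * ξ ≤ r / 2 := by
      have h2K : 2 * ξ ≤ K := by rw [hK]; nlinarith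
      calc δ * ξ = 2 * ξ * δ * 1 / 2 := by ring
        _ ≤ 2 * ξ * δ * L / 2 := by gcongr
        _ ≤ K * δ * L / 2 := by gcongr
    have hs : c * L < (⌊r / (4 * δ)⌋₊ : ℝ) + 1 := by
      have h4K : 4 * c ≤ K := by rw [hK]; nlinarith
      have h1 : c * L ≤ r / (4 * δ) := by
        rw [le_div_iff₀ (by positivity), hr]
        calc c * L * (4 * δ) = 4 * c * δ * L := by ring
          _ ≤ K * δ * L := by gcongr
      exact h1.trans_lt (Nat.lt_floor_add_one _)
    refine measure_mono fun γ hγ => ?_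
    by_contra hhole
    have hM := gridSize_sq_le_of_not_hasLargeHole hδ0 hr0 hr2 hδr hξr (hAB δ hδ0).1.1 hs γ hhole
    have hM1 : 1 / (8 * r) ≤ (gridSize r : ℝ) := by
      have hy : (2 : ℝ) ≤ 1 / (4 * r) := by
        rw [le_div_iff₀ (by positivity)]; linarith
      have hfl := Nat.sub_one_lt_floor (1 / (4 * r))
      have heq : 1 / (8 * r) = 1 / (4 * r) / 2 := by
        field_simp; ring
      unfold gridSize
      rw [heq]
      linarith
    have hM2 : (1 / (8 * r)) ^ 2 ≤ (γ.length : ℝ) + 1 :=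
      calc (1 / (8 * r)) ^ 2 ≤ (gridSize r : ℝ) ^ 2 := by gcongr
        _ ≤ (γ.length : ℝ) + 1 := by exact_mod_cast hM
    have hγ' : ((γ.length : ℝ) + 1) * (δ ^ 2 * L ^ 2) < 1 / (64 * K ^ 2) := hγ
    have hid : (1 / (8 * r)) ^ 2 * (δ ^ 2 * L ^ 2) = 1 / (64 * K ^ 2) := by
      rw [hr]; field_simp; ring
    have hle : (1 / (8 * r)) ^ 2 * (δ ^ 2 * L ^ 2) ≤ ((γ.length : ℝ) + 1) * (δ ^ 2 * L ^ 2) := by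
      gcongr
    linarith
  exact tendsto_of_tendsto_of_tendsto_of_le_of_le' tendsto_const_nhds hT
    (Eventually.of_forall fun δ => zero_le) hev

end Long

/-! ### The law as a ratio of finite sums; monotonicity of the length in the fugacity -/

section Ratio

variable {δ : ℝ} {u v : Site 2}

/-- An algebraic rearrangement: termwise `xⁿ yᵐ ≤ yⁿ xᵐ` for `m ≤ n`, `0 ≤ x ≤ y`, summed over a
product of index sets. [folklore] -/
theorem sum_mul_sum_le_of_forall_le {ι : Type*} (T : Finset ι) (p : ι → Prop) [DecidablePred p]
    (n : ι → ℕ) (hp : ∀ i ∈ T, ∀ j ∈ T, p i → ¬ p j → n j ≤ n i) {x y : ℝ} (hx : 0 ≤ x)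
    (hxy : x ≤ y) :
    (∑ i ∈ T.filter p, x ^ n i) * (∑ j ∈ T.filter (fun j => ¬ p j), y ^ n j) ≤
      (∑ i ∈ T.filter p, y ^ n i) * (∑ j ∈ T.filter (fun j => ¬ p j), x ^ n j) := by
  rw [Finset.sum_mul_sum, Finset.sum_mul_sum]
  refine Finset.sum_le_sum fun i hi => Finset.sum_le_sum fun j hj => ?_
  obtain ⟨hiT, hpi⟩ := Finset.mem_filter.1 hi
  obtain ⟨hjT, hpj⟩ := Finset.mem_filter.1 hj
  obtain ⟨d, hd⟩ := Nat.exists_eq_add_of_le (hp i hiT j hjT hpi hpj)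
  have hy : 0 ≤ y := hx.trans hxy
  have hd' : x ^ d ≤ y ^ d := pow_le_pow_left₀ hx hxy d
  rw [hd, pow_add, pow_add]
  calc x ^ n j * x ^ d * y ^ n j = (x ^ n j * y ^ n j) * x ^ d := by ring
    _ ≤ (x ^ n j * y ^ n j) * y ^ d :=
        mul_le_mul_of_nonneg_left hd' (mul_nonneg (pow_nonneg hx _) (pow_nonneg hy _))
    _ = y ^ n j * y ^ d * x ^ n j := by ring

/-- `a/(a+b) ≤ a'/(a'+b')` from the cross inequality `a b' ≤ a' b`. [folklore] -/
theorem div_add_le_div_add {a b a' b' : ℝ} (hpos : 0 < a + b) (hpos' : 0 < a' + b')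
    (h : a * b' ≤ a' * b) : a / (a + b) ≤ a' / (a' + b') := by
  rw [div_le_div_iff₀ hpos hpos']
  nlinarith [h]

/-- The partition function is positive: `Σ_γ x^{|γ|} > 0` for `x > 0` (there is a walk between
any two sites of `𝔻_δ`). [cite: DuminilCopinKozmaYadin2014, §1 (definition of P_{(Ω_δ,a_δ,b_δ,x)})] -/
theorem sum_pow_length_pos (hδ : 0 < δ) (hu : u ∈ meshDomain unitDisk δ) (hv : v ∈ meshDomain unitDisk δ)
    {x : ℝ} (hx : 0 < x) [Fintype (DomainSAW unitDisk δ u v)] :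
    0 < ∑ γ : DomainSAW unitDisk δ u v, x ^ γ.length := by
  obtain ⟨γ₀, -⟩ := exists_domainSAW_length_le (v := v) hδ hu hv
  exact lt_of_lt_of_le (pow_pos hx _)
    (Finset.single_le_sum (fun γ _ => (pow_pos hx γ.length).le) (Finset.mem_univ γ₀))

/-- **The law as a ratio of finite sums**: `P_{(𝔻_δ,u,v,x)}(E) = Σ_{γ ∈ E} x^{|γ|} / Σ_γ x^{|γ|}`
(`x > 0`, `u, v ∈ 𝔻_δ`). [cite: DuminilCopinKozmaYadin2014, §1 (definition of P_{(Ω_δ,a_δ,b_δ,x)})] -/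
theorem lawAt_apply_eq_ofReal_div (hδ : 0 < δ) (hu : u ∈ meshDomain unitDisk δ)
    (hv : v ∈ meshDomain unitDisk δ) {x : ℝ} (hx : 0 < x) [Fintype (DomainSAW unitDisk δ u v)]
    (E : Set (DomainSAW unitDisk δ u v)) [DecidablePred (· ∈ E)] :
    lawAt x unitDisk δ u v E = ENNReal.ofReal
      ((∑ γ ∈ Finset.univ.filter (· ∈ E), x ^ γ.length) /
        (∑ γ : DomainSAW unitDisk δ u v, x ^ γ.length)) := by
  classical
  have hS := sum_pow_length_pos hδ hu hv hx
  have huniv : weightAt x unitDisk δ u v Set.univ =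
      ENNReal.ofReal (∑ γ : DomainSAW unitDisk δ u v, x ^ γ.length) := by
    rw [weightAt_apply_eq_sum, ← ENNReal.ofReal_sum_of_nonneg (fun γ _ => (pow_pos hx _).le)]
    congr 1
    exact Finset.sum_congr (by ext γ; simp) (fun _ _ => rfl)
  have hE : weightAt x unitDisk δ u v E =
      ENNReal.ofReal (∑ γ ∈ Finset.univ.filter (· ∈ E), x ^ γ.length) := by
    rw [weightAt_apply_eq_sum, ← ENNReal.ofReal_sum_of_nonneg (fun γ _ => (pow_pos hx _).le)]
  rw [lawAt, Measure.smul_apply, smul_eq_mul, huniv, hE, ENNReal.ofReal_div_of_pos hS,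
    ENNReal.div_eq_inv_mul]

/-- For `x > 0` and endpoints in `𝔻_δ` the fugacity-`x` law is a probability measure.
[cite: DuminilCopinKozmaYadin2014, §1 (definition of P_{(Ω_δ,a_δ,b_δ,x)})] -/
theorem isProbabilityMeasure_lawAt (hδ : 0 < δ) (hu : u ∈ meshDomain unitDisk δ)
    (hv : v ∈ meshDomain unitDisk δ) {x : ℝ} (hx : 0 < x) :
    IsProbabilityMeasure (lawAt x unitDisk δ u v) := by
  classical
  haveI := finite_domainSAW (v := v) hδ hu
  haveI : Fintype (DomainSAW unitDisk δ u v) := Fintype.ofFinite _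
  refine ⟨?_⟩
  rw [lawAt_apply_eq_ofReal_div hδ hu hv hx]
  have hS := sum_pow_length_pos hδ hu hv hx
  have : (∑ γ ∈ Finset.univ.filter (· ∈ (Set.univ : Set (DomainSAW unitDisk δ u v))), x ^ γ.length) =
      ∑ γ : DomainSAW unitDisk δ u v, x ^ γ.length :=
    Finset.sum_congr (by ext γ; simp) (fun _ _ => rfl)
  rw [this, div_self hS.ne', ENNReal.ofReal_one]

/-- **The length is stochastically increasing in the fugacity**: for `0 < x ≤ y` and every
threshold `L`, `P_{(𝔻_δ,u,v,x)}[|γ| > L] ≤ P_{(𝔻_δ,u,v,y)}[|γ| > L]` (the family `x^{|γ|}` has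
monotone likelihood ratio in `|γ|`). [cite: DuminilCopinKozmaYadin2014, §1 (definition of P_{(Ω_δ,a_δ,b_δ,x)})] -/
theorem lawAt_setOf_lt_length_mono (hδ : 0 < δ) (hu : u ∈ meshDomain unitDisk δ)
    (hv : v ∈ meshDomain unitDisk δ) {x y : ℝ} (hx : 0 < x) (hxy : x ≤ y) (L : ℝ) :
    lawAt x unitDisk δ u v {γ | L < γ.length} ≤ lawAt y unitDisk δ u v {γ | L < γ.length} := by
  classical
  haveI := finite_domainSAW (v := v) hδ hu
  haveI : Fintype (DomainSAW unitDisk δ u v) := Fintype.ofFinite _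
  have hy : 0 < y := hx.trans_le hxy
  rw [lawAt_apply_eq_ofReal_div hδ hu hv hx, lawAt_apply_eq_ofReal_div hδ hu hv hy]
  refine ENNReal.ofReal_le_ofReal ?_
  set T : Finset (DomainSAW unitDisk δ u v) := Finset.univ with hT
  set p : DomainSAW unitDisk δ u v → Prop := fun γ => γ ∈ ({γ | L < γ.length} : Set _) with hp
  have hsplit : ∀ z : ℝ, ∑ γ : DomainSAW unitDisk δ u v, z ^ γ.length =
      (∑ γ ∈ T.filter p, z ^ γ.length) + ∑ γ ∈ T.filter (fun γ => ¬ p γ), z ^ γ.length :=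
    fun z => (Finset.sum_filter_add_sum_filter_not T p _).symm
  rw [hsplit x, hsplit y]
  have hcross := sum_mul_sum_le_of_forall_le T p (fun γ => γ.length) (fun i _ j _ hi hj => by
    have hi' : L < (i.length : ℝ) := hi
    have hj' : ¬ L < (j.length : ℝ) := hj
    have : (j.length : ℝ) < i.length := (not_lt.1 hj').trans_lt hi'
    exact_mod_cast this.le) hx.le hxy
  refine div_add_le_div_add ?_ ?_ hcross
  · rw [← hsplit x]; exact sum_pow_length_pos hδ hu hv hx
  · rw [← hsplit y]; exact sum_pow_length_pos hδ hu hv hy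

end Ratio

/-! ### Tuned fugacities: a `μ`-free sequence converging to `x_c` -/

section Tuned

variable {A B : ℝ → Site 2} {L : ℝ → ℝ}

/-- **Supercritical side of a length threshold**: for `x > x_c` (closest-site endpoints of
boundary points `a ≠ b`) and a threshold `L(δ)` with `(L(δ) + 1) δ² log²(1/δ) → 0`,
`P_{(𝔻_δ,a_δ,b_δ,x)}[|γ_δ| ≤ L(δ)] → 0` (`tendsto_lawAt_length_mul_lt_of_lt`).
[cite: DuminilCopinKozmaYadin2014, Theorem 1 and §4 (Problem 9)] -/
theorem tendsto_lawAt_not_lt_length_of_lt {x : ℝ} (hx : criticalFugacity < x) {a b : ℂ}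
    (ha : ‖a‖ = 1) (hb : ‖b‖ = 1) (hab : a ≠ b)
    (hAB : ∀ δ : ℝ, 0 < δ → IsClosestSite unitDisk δ a (A δ) ∧ IsClosestSite unitDisk δ b (B δ))
    (hL : Tendsto (fun δ : ℝ => (L δ + 1) * (δ ^ 2 * Real.log (1 / δ) ^ 2)) (𝓝[>] 0) (𝓝 0)) :
    Tendsto (fun δ : ℝ => lawAt x unitDisk δ (A δ) (B δ) {γ | ¬ L δ < γ.length}) (𝓝[>] 0) (𝓝 0) := by
  obtain ⟨κ₀, hκ₀, hT⟩ := tendsto_lawAt_length_mul_lt_of_lt hx ha hb hab hAB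
  have hev : ∀ᶠ δ in 𝓝[>] (0 : ℝ), (L δ + 1) * (δ ^ 2 * Real.log (1 / δ) ^ 2) < κ₀ :=
    hL.eventually (Iio_mem_nhds hκ₀)
  refine tendsto_of_tendsto_of_tendsto_of_le_of_le' tendsto_const_nhds hT
    (Eventually.of_forall fun δ => zero_le) ?_
  filter_upwards [hev] with δ hδ
  refine measure_mono fun γ hγ => ?_
  have hγ' : (γ.length : ℝ) ≤ L δ := not_lt.1 hγ
  have h0 : 0 ≤ δ ^ 2 * Real.log (1 / δ) ^ 2 := by positivity
  calc ((γ.length : ℝ) + 1) * (δ ^ 2 * Real.log (1 / δ) ^ 2)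
      ≤ (L δ + 1) * (δ ^ 2 * Real.log (1 / δ) ^ 2) := by gcongr
    _ < κ₀ := hδ

/-- **Subcritical side of a length threshold**: for `0 < x < x_c` (any endpoints in `𝔻_δ`) and a
threshold with `δ L(δ) → ∞`, `P_{(𝔻_δ,u_δ,v_δ,x)}[|γ_δ| > L(δ)] → 0`
(`tendsto_lawAt_length_lt_of_lt_criticalFugacity`). [cite: DuminilCopinKozmaYadin2014, §1 (When x < 1/μ)] -/
theorem tendsto_lawAt_lt_length_of_lt_criticalFugacity {x : ℝ} (hx0 : 0 < x) (hxc : x < criticalFugacity)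
    (hAB : ∀ δ : ℝ, 0 < δ → A δ ∈ meshDomain unitDisk δ ∧ B δ ∈ meshDomain unitDisk δ)
    (hL : Tendsto (fun δ : ℝ => δ * L δ) (𝓝[>] 0) atTop) :
    Tendsto (fun δ : ℝ => lawAt x unitDisk δ (A δ) (B δ) {γ | L δ < γ.length}) (𝓝[>] 0) (𝓝 0) := by
  obtain ⟨C, hC, hT⟩ := tendsto_lawAt_length_lt_of_lt_criticalFugacity hx0 hxc hAB
  have hev : ∀ᶠ δ in 𝓝[>] (0 : ℝ), C ≤ δ * L δ := hL.eventually (eventually_ge_atTop C)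
  refine tendsto_of_tendsto_of_tendsto_of_le_of_le' tendsto_const_nhds hT
    (Eventually.of_forall fun δ => zero_le) ?_
  filter_upwards [hev, self_mem_nhdsWithin] with δ hδ hδ0
  have hδ0' : (0 : ℝ) < δ := hδ0
  refine measure_mono fun γ hγ => ?_
  have hγ' : L δ < (γ.length : ℝ) := hγ
  show C / δ < (γ.length : ℝ)
  rw [div_lt_iff₀ hδ0']
  nlinarith

/-- **A tuned fugacity sequence converges to `x_c`.** Let `a ≠ b` be boundary points of `𝔻`
with closest-site endpoints, `L(δ)` a length threshold between the two phases (`δ L(δ) → ∞`,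
`(L(δ)+1) δ² log²(1/δ) → 0`; e.g. `L(δ) = δ^{-4/3}`), `t ∈ (0, 1)`, and `x_δ > 0` fugacities with
`P_{(𝔻_δ,a_δ,b_δ,x_δ)}[|γ_δ| > L(δ)] = t` for all small `δ`. Then `x_δ → x_c = 1/μ(ℤ²)`: by the
stochastic monotonicity of the length in the fugacity (`lawAt_setOf_lt_length_mono`), `x_δ`
cannot stay above `x_c + ε` (there the probability tends to `1`, supercritical walks being long)
nor below `x_c - ε` (there it tends to `0`, subcritical walks being short). No value of `μ`
enters the definition of such a sequence. [cite: DuminilCopinKozmaYadin2014, §1 and Theorem 1] -/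
theorem tendsto_criticalFugacity_of_tuned {a b : ℂ} (ha : ‖a‖ = 1) (hb : ‖b‖ = 1) (hab : a ≠ b)
    (hAB : ∀ δ : ℝ, 0 < δ → IsClosestSite unitDisk δ a (A δ) ∧ IsClosestSite unitDisk δ b (B δ))
    (hL1 : Tendsto (fun δ : ℝ => δ * L δ) (𝓝[>] 0) atTop)
    (hL2 : Tendsto (fun δ : ℝ => (L δ + 1) * (δ ^ 2 * Real.log (1 / δ) ^ 2)) (𝓝[>] 0) (𝓝 0))
    {t : ℝ} (ht0 : 0 < t) (ht1 : t < 1) {x : ℝ → ℝ}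
    (hx : ∀ᶠ δ in 𝓝[>] (0 : ℝ), 0 < x δ ∧
      lawAt (x δ) unitDisk δ (A δ) (B δ) {γ | L δ < γ.length} = ENNReal.ofReal t) :
    Tendsto x (𝓝[>] 0) (𝓝 criticalFugacity) := by
  have hmem : ∀ δ : ℝ, 0 < δ → A δ ∈ meshDomain unitDisk δ ∧ B δ ∈ meshDomain unitDisk δ :=
    fun δ hδ => ⟨(hAB δ hδ).1.1, (hAB δ hδ).2.1⟩
  rw [Metric.tendsto_nhds]
  intro ε hε
  -- upper side: at `x₂ = x_c + ε/2` the complementary probability is eventually `< 1 - t`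
  set x₂ : ℝ := criticalFugacity + ε / 2 with hx₂
  have hx₂c : criticalFugacity < x₂ := by rw [hx₂]; linarith
  have hx₂0 : 0 < x₂ := criticalFugacity_pos.trans hx₂c
  have hup : ∀ᶠ δ in 𝓝[>] (0 : ℝ),
      (lawAt x₂ unitDisk δ (A δ) (B δ) {γ | ¬ L δ < γ.length}).toReal < 1 - t := by
    have h := (ENNReal.tendsto_toReal ENNReal.zero_ne_top).comp
      (tendsto_lawAt_not_lt_length_of_lt hx₂c ha hb hab hAB hL2)
    rw [ENNReal.toReal_zero] at h
    exact h.eventually (Iio_mem_nhds (by linarith))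
  -- lower side: at `x₁ = x_c - ε/2` (if positive) the probability is eventually `< t`
  have hlow : ∀ᶠ δ in 𝓝[>] (0 : ℝ), 0 < criticalFugacity - ε / 2 →
      (lawAt (criticalFugacity - ε / 2) unitDisk δ (A δ) (B δ) {γ | L δ < γ.length}).toReal < t := by
    by_cases h1 : 0 < criticalFugacity - ε / 2
    · have h := (ENNReal.tendsto_toReal ENNReal.zero_ne_top).comp
        (tendsto_lawAt_lt_length_of_lt_criticalFugacity h1 (by linarith) hmem hL1)
      rw [ENNReal.toReal_zero] at h
      filter_upwards [h.eventually (Iio_mem_nhds ht0)] with δ hδ _ using hδ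
    · exact Eventually.of_forall fun δ h => absurd h h1
  filter_upwards [hup, hlow, hx, self_mem_nhdsWithin] with δ hupδ hlowδ hxδ hδ0
  have hδ : (0 : ℝ) < δ := hδ0
  obtain ⟨hx0, hxt⟩ := hxδ
  obtain ⟨hu, hv⟩ := hmem δ hδ
  set s : Set (DomainSAW unitDisk δ (A δ) (B δ)) := {γ | L δ < γ.length} with hs
  have hsm : MeasurableSet s := MeasurableSpace.measurableSet_top
  have hxt' : (lawAt (x δ) unitDisk δ (A δ) (B δ) s).toReal = t := by
    rw [hxt, ENNReal.toReal_ofReal ht0.le]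
  rw [Real.dist_eq, abs_lt]
  constructor
  · -- `x δ > x_c - ε/2`
    by_cases h1 : 0 < criticalFugacity - ε / 2
    · have hlt : criticalFugacity - ε / 2 < x δ := by
        by_contra hle
        have hle' : x δ ≤ criticalFugacity - ε / 2 := not_lt.1 hle
        haveI := isProbabilityMeasure_lawAt hδ hu hv h1
        have hmono := lawAt_setOf_lt_length_mono hδ hu hv hx0 hle' (L δ)
        have h2 : t ≤ (lawAt (criticalFugacity - ε / 2) unitDisk δ (A δ) (B δ) s).toReal := by
          rw [← hxt']
          exact ENNReal.toReal_mono (measure_ne_top _ _) hmono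
        linarith [hlowδ h1]
      linarith
    · linarith
  · -- `x δ < x_c + ε/2`
    have hlt : x δ < x₂ := by
      by_contra hle
      have hle' : x₂ ≤ x δ := not_lt.1 hle
      haveI := isProbabilityMeasure_lawAt hδ hu hv hx0
      haveI h2P := isProbabilityMeasure_lawAt hδ hu hv hx₂0
      have hmono := lawAt_setOf_lt_length_mono hδ hu hv hx₂0 hle' (L δ)
      have h2 : (lawAt x₂ unitDisk δ (A δ) (B δ) s).toReal ≤ t := by
        rw [← hxt']
        exact ENNReal.toReal_mono (measure_ne_top _ _) hmono
      have hcompl : (lawAt x₂ unitDisk δ (A δ) (B δ)).real sᶜ =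
          1 - (lawAt x₂ unitDisk δ (A δ) (B δ)).real s := probReal_compl_eq_one_sub hsm
      have hc' : sᶜ = {γ | ¬ L δ < γ.length} := by rw [hs, Set.compl_setOf]
      rw [measureReal_def, measureReal_def, hc'] at hcompl
      linarith
    rw [hx₂] at hlt
    linarith

/-- **Existence of tuned fugacities.** In the setting of `tendsto_criticalFugacity_of_tuned`, for
every `t ∈ (0, 1)` and all small `δ` there is a fugacity `x_δ ∈ (0, x_c + 1]` with
`P_{(𝔻_δ,a_δ,b_δ,x_δ)}[|γ_δ| > L(δ)] = t` EXACTLY: the probability is a continuous function of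
the fugacity (a ratio of polynomials with positive denominator), at most `#SAW · x` for `x ≤ 1`
once `L(δ) ≥ 4/δ` (a reference walk through the centre has `≤ 4/δ` steps), and `> t` at
`x_c + 1` for small `δ` — intermediate value theorem. [cite: DuminilCopinKozmaYadin2014, §1 and Theorem 1] -/
theorem exists_tuned {a b : ℂ} (ha : ‖a‖ = 1) (hb : ‖b‖ = 1) (hab : a ≠ b)
    (hAB : ∀ δ : ℝ, 0 < δ → IsClosestSite unitDisk δ a (A δ) ∧ IsClosestSite unitDisk δ b (B δ))
    (hL1 : Tendsto (fun δ : ℝ => δ * L δ) (𝓝[>] 0) atTop)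
    (hL2 : Tendsto (fun δ : ℝ => (L δ + 1) * (δ ^ 2 * Real.log (1 / δ) ^ 2)) (𝓝[>] 0) (𝓝 0))
    {t : ℝ} (ht0 : 0 < t) (ht1 : t < 1) :
    ∀ᶠ δ in 𝓝[>] (0 : ℝ), ∃ z ∈ Set.Ioc 0 (criticalFugacity + 1),
      lawAt z unitDisk δ (A δ) (B δ) {γ | L δ < γ.length} = ENNReal.ofReal t := by
  have hmem : ∀ δ : ℝ, 0 < δ → A δ ∈ meshDomain unitDisk δ ∧ B δ ∈ meshDomain unitDisk δ :=
    fun δ hδ => ⟨(hAB δ hδ).1.1, (hAB δ hδ).2.1⟩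
  set x₂ : ℝ := criticalFugacity + 1 with hx₂
  have hxc := criticalFugacity_pos
  have hx₂c : criticalFugacity < x₂ := by rw [hx₂]; linarith
  have hx₂0 : 0 < x₂ := hxc.trans hx₂c
  have hup : ∀ᶠ δ in 𝓝[>] (0 : ℝ),
      (lawAt x₂ unitDisk δ (A δ) (B δ) {γ | ¬ L δ < γ.length}).toReal < 1 - t := by
    have h := (ENNReal.tendsto_toReal ENNReal.zero_ne_top).comp
      (tendsto_lawAt_not_lt_length_of_lt hx₂c ha hb hab hAB hL2)
    rw [ENNReal.toReal_zero] at h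
    exact h.eventually (Iio_mem_nhds (by linarith))
  have h4 : ∀ᶠ δ in 𝓝[>] (0 : ℝ), 4 ≤ δ * L δ := hL1.eventually (eventually_ge_atTop 4)
  filter_upwards [hup, h4, self_mem_nhdsWithin] with δ hupδ h4δ hδ0
  have hδ : (0 : ℝ) < δ := hδ0
  obtain ⟨hu, hv⟩ := hmem δ hδ
  classical
  haveI := finite_domainSAW (v := B δ) hδ hu
  haveI : Fintype (DomainSAW unitDisk δ (A δ) (B δ)) := Fintype.ofFinite _
  set s : Set (DomainSAW unitDisk δ (A δ) (B δ)) := {γ | L δ < γ.length} with hs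
  -- the ratio function
  set num : ℝ → ℝ := fun z => ∑ γ ∈ Finset.univ.filter (· ∈ s), z ^ γ.length with hnum
  set den : ℝ → ℝ := fun z => ∑ γ : DomainSAW unitDisk δ (A δ) (B δ), z ^ γ.length with hden
  set g : ℝ → ℝ := fun z => num z / den z with hg
  have hlaw : ∀ z : ℝ, 0 < z → lawAt z unitDisk δ (A δ) (B δ) s = ENNReal.ofReal (g z) :=
    fun z hz => lawAt_apply_eq_ofReal_div hδ hu hv hz s
  have hden0 : ∀ z : ℝ, 0 < z → 0 < den z := fun z hz => sum_pow_length_pos hδ hu hv hz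
  have hnum0 : ∀ z : ℝ, 0 ≤ z → 0 ≤ num z := fun z hz =>
    Finset.sum_nonneg fun γ _ => pow_nonneg hz _
  have hg0 : ∀ z : ℝ, 0 < z → 0 ≤ g z := fun z hz => div_nonneg (hnum0 z hz.le) (hden0 z hz).le
  -- continuity on `(0, ∞)`
  have hcont : ContinuousOn g (Set.Ioi 0) := by
    have hn : Continuous num := by
      rw [hnum]
      exact continuous_finsetSum _ fun γ _ => continuous_pow _
    have hd : Continuous den := by
      rw [hden]
      exact continuous_finsetSum _ fun γ _ => continuous_pow _
    exact hn.continuousOn.div hd.continuousOn fun z hz => (hden0 z hz).ne'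
  -- the value at `x₂` exceeds `t`
  have hsm : MeasurableSet s := MeasurableSpace.measurableSet_top
  have hg₂ : t < g x₂ := by
    haveI := isProbabilityMeasure_lawAt hδ hu hv hx₂0
    have hcompl : (lawAt x₂ unitDisk δ (A δ) (B δ)).real sᶜ =
        1 - (lawAt x₂ unitDisk δ (A δ) (B δ)).real s := probReal_compl_eq_one_sub hsm
    have hc' : sᶜ = {γ | ¬ L δ < γ.length} := by rw [hs, Set.compl_setOf]
    rw [measureReal_def, measureReal_def, hc', hlaw x₂ hx₂0, ENNReal.toReal_ofReal (hg0 x₂ hx₂0)]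
      at hcompl
    linarith
  -- a small fugacity `x₁` with `g x₁ < t`
  set N : ℕ := Fintype.card (DomainSAW unitDisk δ (A δ) (B δ)) with hN
  set x₁ : ℝ := min 1 (t / (2 * ((N : ℝ) + 1))) with hx₁
  have hx₁0 : 0 < x₁ := lt_min one_pos (by positivity)
  have hx₁1 : x₁ ≤ 1 := min_le_left _ _
  have hg₁ : g x₁ < t := by
    obtain ⟨γ₀, hγ₀⟩ := exists_domainSAW_length_le (v := B δ) hδ hu hv
    have hL4 : (4 : ℝ) / δ ≤ L δ := by rw [div_le_iff₀ hδ]; linarith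
    -- numerator ≤ N x₁^{n₀+1}, denominator ≥ x₁^{n₀}
    have hnum1 : num x₁ ≤ N * x₁ ^ (γ₀.length + 1) := by
      calc num x₁ ≤ ∑ γ ∈ Finset.univ.filter (· ∈ s), x₁ ^ (γ₀.length + 1) := by
            refine Finset.sum_le_sum fun γ hγ => ?_
            have hγs : L δ < (γ.length : ℝ) := (Finset.mem_filter.1 hγ).2
            have hlen : γ₀.length + 1 ≤ γ.length := by
              have : (γ₀.length : ℝ) < γ.length := by linarith
              exact_mod_cast this
            exact pow_le_pow_of_le_one hx₁0.le hx₁1 hlen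
        _ = ((Finset.univ.filter (· ∈ s)).card : ℝ) * x₁ ^ (γ₀.length + 1) := by
            rw [Finset.sum_const, nsmul_eq_mul]
        _ ≤ N * x₁ ^ (γ₀.length + 1) := by
            gcongr
            exact_mod_cast (Finset.card_filter_le _ _).trans
              (Finset.card_univ (α := DomainSAW unitDisk δ (A δ) (B δ))).le
    have hden1 : x₁ ^ γ₀.length ≤ den x₁ :=
      Finset.single_le_sum (fun γ _ => (pow_pos hx₁0 γ.length).le) (Finset.mem_univ γ₀)
    have hpow : 0 < x₁ ^ γ₀.length := pow_pos hx₁0 _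
    calc g x₁ = num x₁ / den x₁ := rfl
      _ ≤ N * x₁ ^ (γ₀.length + 1) / x₁ ^ γ₀.length := by
          have := hden0 x₁ hx₁0
          gcongr
      _ = N * x₁ := by rw [pow_succ]; field_simp
      _ ≤ N * (t / (2 * ((N : ℝ) + 1))) := by gcongr; exact min_le_right _ _
      _ < t := by
          rw [mul_div_assoc']
          rw [div_lt_iff₀ (by positivity)]
          nlinarith
  -- intermediate value theorem on `[x₁, x₂]`
  have hx₁₂ : x₁ ≤ x₂ := hx₁1.trans (by rw [hx₂]; linarith)
  have hIcc : Set.Icc x₁ x₂ ⊆ Set.Ioi 0 := fun z hz => hx₁0.trans_le hz.1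
  obtain ⟨z, hz, hgz⟩ := intermediate_value_Icc hx₁₂ (hcont.mono hIcc) ⟨hg₁.le, hg₂.le⟩
  have hz0 : 0 < z := hx₁0.trans_le hz.1
  exact ⟨z, ⟨hz0, hz.2⟩, by rw [hlaw z hz0, hgz]⟩

/-- **The threshold `L(δ) = δ^{-4/3}` is admissible** (the conjectured critical length scale):
`δ · δ^{-4/3} = δ^{-1/3} → ∞` and `(δ^{-4/3} + 1) δ² log²(1/δ) = (δ^{1/3} log δ)² + (δ log δ)² → 0`.
[folklore] -/
theorem admissible_rpow_neg_four_thirds :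
    Tendsto (fun δ : ℝ => δ * δ ^ (-(4 : ℝ) / 3)) (𝓝[>] 0) atTop ∧
      Tendsto (fun δ : ℝ => (δ ^ (-(4 : ℝ) / 3) + 1) * (δ ^ 2 * Real.log (1 / δ) ^ 2))
        (𝓝[>] 0) (𝓝 0) := by
  constructor
  · have h : Tendsto (fun δ : ℝ => δ ^ (-(1 : ℝ) / 3)) (𝓝[>] 0) atTop :=
      tendsto_rpow_neg_nhdsGT_zero (by norm_num)
    refine h.congr' ?_
    filter_upwards [self_mem_nhdsWithin] with δ hδ
    have hδ' : (0 : ℝ) < δ := hδ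
    calc δ ^ (-(1 : ℝ) / 3) = δ ^ ((1 : ℝ) + -(4 : ℝ) / 3) := by norm_num
      _ = δ * δ ^ (-(4 : ℝ) / 3) := by rw [Real.rpow_add hδ', Real.rpow_one]
  · have h1 := tendsto_log_mul_rpow_nhdsGT_zero (by norm_num : (0 : ℝ) < 1 / 3)
    have h2 := tendsto_log_mul_rpow_nhdsGT_zero zero_lt_one
    have h3 := (h1.pow 2).add (h2.pow 2)
    rw [zero_pow two_ne_zero, add_zero] at h3
    refine h3.congr' ?_
    filter_upwards [self_mem_nhdsWithin] with δ hδ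
    have hδ' : (0 : ℝ) < δ := hδ
    have hlog : Real.log (1 / δ) = -Real.log δ := by rw [one_div, Real.log_inv]
    have hkey : δ ^ (-(4 : ℝ) / 3) * δ ^ (2 : ℕ) = (δ ^ ((1 : ℝ) / 3)) ^ (2 : ℕ) := by
      rw [← Real.rpow_natCast δ 2, ← Real.rpow_add hδ', ← Real.rpow_natCast (δ ^ ((1 : ℝ) / 3)) 2,
        ← Real.rpow_mul hδ'.le]
      norm_num
    rw [hlog, Real.rpow_one]
    have hexp : (δ ^ (-(4 : ℝ) / 3) + 1) * (δ ^ 2 * (-Real.log δ) ^ 2) =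
        (δ ^ (-(4 : ℝ) / 3) * δ ^ 2 + δ ^ 2) * Real.log δ ^ 2 := by ring
    rw [hexp, hkey]
    ring

end Tuned

/-! ### The concrete instance: `L(δ) = δ^{-4/3}`, `t = 1/2`, the disc `(𝔻; 1, -1)` -/

section Instance

/-- **A `μ`-free near-critical sequence exists**: for the closest-site endpoints of `(𝔻; 1, -1)`
and all small `δ` there is `x_δ ∈ (0, x_c + 1]` at which the fugacity-`x_δ` SAW has more than
`δ^{-4/3}` steps with probability exactly `1/2`. [cite: DuminilCopinKozmaYadin2014, §1 and Theorem 1] -/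
theorem exists_tuned_unitDisc {A B : ℝ → Site 2}
    (hAB : ∀ δ : ℝ, 0 < δ → IsClosestSite unitDisk δ 1 (A δ) ∧ IsClosestSite unitDisk δ (-1) (B δ)) :
    ∀ᶠ δ in 𝓝[>] (0 : ℝ), ∃ z ∈ Set.Ioc 0 (criticalFugacity + 1),
      lawAt z unitDisk δ (A δ) (B δ) {γ | δ ^ (-(4 : ℝ) / 3) < γ.length} = ENNReal.ofReal (1 / 2) := by
  have hne : (1 : ℂ) ≠ -1 := fun h => by
    have h' := congrArg Complex.re h
    norm_num at h'
  exact exists_tuned (L := fun δ => δ ^ (-(4 : ℝ) / 3)) (by simp) (by simp) hne hAB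
    admissible_rpow_neg_four_thirds.1 admissible_rpow_neg_four_thirds.2 (by norm_num) (by norm_num)

/-- **Every such sequence converges to `x_c = 1/μ(ℤ²)`**: if `x_δ > 0` and the fugacity-`x_δ` SAW
of `(𝔻; 1, -1)` (closest-site endpoints) has more than `δ^{-4/3}` steps with probability `1/2`
for all small `δ`, then `x_δ → x_c`. [cite: DuminilCopinKozmaYadin2014, §1 and Theorem 1] -/
theorem tendsto_criticalFugacity_of_tuned_unitDisc {A B : ℝ → Site 2}
    (hAB : ∀ δ : ℝ, 0 < δ → IsClosestSite unitDisk δ 1 (A δ) ∧ IsClosestSite unitDisk δ (-1) (B δ))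
    {x : ℝ → ℝ} (hx : ∀ᶠ δ in 𝓝[>] (0 : ℝ), 0 < x δ ∧
      lawAt (x δ) unitDisk δ (A δ) (B δ) {γ | δ ^ (-(4 : ℝ) / 3) < γ.length} = ENNReal.ofReal (1 / 2)) :
    Tendsto x (𝓝[>] 0) (𝓝 criticalFugacity) := by
  have hne : (1 : ℂ) ≠ -1 := fun h => by
    have h' := congrArg Complex.re h
    norm_num at h'
  exact tendsto_criticalFugacity_of_tuned (L := fun δ => δ ^ (-(4 : ℝ) / 3)) (by simp) (by simp) hne
    hAB admissible_rpow_neg_four_thirds.1 admissible_rpow_neg_four_thirds.2 (by norm_num)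
    (by norm_num) hx

/-- **A critical sequence of fugacities, by choice**: for the closest-site endpoints of
`(𝔻; 1, -1)` there is a family `x_δ > 0`, tuned for all small `δ` (`P_{x_δ}[|γ_δ| > δ^{-4/3}] = 1/2`)
and converging to `x_c = 1/μ(ℤ²)` — assembled from `exists_tuned_unitDisc` by choice and
`tendsto_criticalFugacity_of_tuned_unitDisc`. [cite: DuminilCopinKozmaYadin2014, §1 and Theorem 1] -/
theorem exists_tuned_tendsto_unitDisc {A B : ℝ → Site 2}
    (hAB : ∀ δ : ℝ, 0 < δ → IsClosestSite unitDisk δ 1 (A δ) ∧ IsClosestSite unitDisk δ (-1) (B δ)) :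
    ∃ x : ℝ → ℝ,
      (∀ᶠ δ in 𝓝[>] (0 : ℝ), 0 < x δ ∧
        lawAt (x δ) unitDisk δ (A δ) (B δ) {γ | δ ^ (-(4 : ℝ) / 3) < γ.length} = ENNReal.ofReal (1 / 2)) ∧
      Tendsto x (𝓝[>] 0) (𝓝 criticalFugacity) := by
  classical
  set P : ℝ → ℝ → Prop := fun δ z => z ∈ Set.Ioc 0 (criticalFugacity + 1) ∧
    lawAt z unitDisk δ (A δ) (B δ) {γ | δ ^ (-(4 : ℝ) / 3) < γ.length} = ENNReal.ofReal (1 / 2) with hP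
  set x : ℝ → ℝ := fun δ => if h : ∃ z, P δ z then h.choose else 1 with hxdef
  have hx : ∀ᶠ δ in 𝓝[>] (0 : ℝ), 0 < x δ ∧
      lawAt (x δ) unitDisk δ (A δ) (B δ) {γ | δ ^ (-(4 : ℝ) / 3) < γ.length} = ENNReal.ofReal (1 / 2) := by
    filter_upwards [exists_tuned_unitDisc hAB] with δ hδ
    have h : ∃ z, P δ z := by
      obtain ⟨z, hz, hz'⟩ := hδ
      exact ⟨z, hz, hz'⟩
    have hxδ : x δ = h.choose := by rw [hxdef]; exact dif_pos h
    have hspec := h.choose_spec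
    rw [hxδ]
    exact ⟨hspec.1.1, hspec.2⟩
  exact ⟨x, hx, tendsto_criticalFugacity_of_tuned_unitDisc hAB hx⟩

end Instance

end SupercriticalSAW

open SupercriticalSAW

/-! ### The audited barrier (sixth audit, part B): the length axis and tuned sequences -/

/-- **Barrier `SupercriticalSAWSpaceFillingTuned`** (sixth audit of the mechanism of
`SupercriticalSAWSpaceFilling`, part B; PROVED below, `SupercriticalSAWSpaceFillingTuned_holds`):
Theorem 1 of Duminil-Copin–Kozma–Yadin together with (a) its length consequence — supercritical
walks of the disc have `≥ κ₀(x) δ⁻²/log²(1/δ)` vertices w.h.p. — and (b) the tuned-sequence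
theorem: every family of fugacities `x_δ > 0` at which the SAW of `(𝔻; 1, -1)` has more than
`δ^{-4/3}` steps with probability exactly `1/2` converges to `x_c = 1/μ(ℤ²)`.

BARRIER (structured block, D-0021):
- technique_class: that of `SupercriticalSAWSpaceFilling` (fugacity-robust, δ-uniform conclusions at a fixed fugacity `x ≠ x_c`), on the LENGTH / natural-parametrisation axis: any argument whose conclusion fixes the length exponent of `γ_δ` — "`|γ_δ| = δ^{-4/3+o(1)}`", a non-trivial `δ^{4/3}`-normalised occupation measure or Minkowski-content parametrisation of dimension `1/ν = 4/3` [cite: LawlerSchrammWerner2004SAW, §1 and Prediction 2], or more generally "`L₁(δ) < |γ_δ| ≤ L₂(δ)` w.h.p." with `δ L₁(δ) → ∞` and `L₂(δ) δ² log²(1/δ) → 0` — and would hold at some fixed `x ≠ x_c`, `x > 0` [cite: DuminilCopinKozmaYadin2014, §1 and §4]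
- blocks: (proved here) for `x > x_c`, closest-site endpoints of boundary points `a ≠ b` of `𝔻`: `P_x[(|γ_δ|+1) δ² log²(1/δ) < κ₀] → 0` (`SupercriticalSAW.tendsto_lawAt_length_mul_lt_of_lt`) and `P_x[|γ_δ| ≤ L(δ)] → 0` for every threshold with `(L(δ)+1) δ² log²(1/δ) → 0` (`SupercriticalSAW.tendsto_lawAt_not_lt_length_of_lt`); for `0 < x < x_c`, any endpoints in `𝔻_δ`: `P_x[|γ_δ| > L(δ)] → 0` whenever `δ L(δ) → ∞` (`SupercriticalSAW.tendsto_lawAt_lt_length_of_lt_criticalFugacity`, from `…SubcriticalLength`); hence every `x`-robust (even one-sided: left OR right) "critical length scale" conclusion is dead, independently of the curve topology of the base barrier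
- because: no hole of `𝔻_δ ∖ Γ_δ^ξ` with more than `c log(1/δ)` sites [cite: DuminilCopinKozmaYadin2014, Theorem 1] forces a visited mesh point in every ball of radius `r = (8 + 2ξ + 8c) δ log(1/δ)` inside `𝔻` (an unvisited ball contains a straight hole segment of `⌊r/(4δ)⌋ + 1 > c log(1/δ)` sites), and `⌊1/(4r)⌋² ≥ 1/(64r²)` such balls centred on the grid `2r(ℤ + iℤ) - (1+i)/4` are pairwise disjoint in `𝔻`, giving as many distinct vertices; below `x_c`, `cₙ xⁿ` is summable [cite: MadrasSlade1993, §1.2] while `Z ≥ x^{4/δ}`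
- evasions_known: NOT obstructed, and proved here to be well-defined and critical: (xi) TUNED fugacity sequences — for `t ∈ (0,1)` and a threshold `L(δ)` between the phases (e.g. `δ^{-4/3}`), fugacities `x_δ ∈ (0, x_c + 1]` with `P_{x_δ}[|γ_δ| > L(δ)] = t` exist for all small `δ` (`SupercriticalSAW.exists_tuned`, `SupercriticalSAW.exists_tuned_unitDisc`: continuity in `x` and the intermediate value theorem) and EVERY such family converges to `x_c` (`SupercriticalSAW.tendsto_criticalFugacity_of_tuned`, `SupercriticalSAW.tendsto_criticalFugacity_of_tuned_unitDisc`: the length is stochastically increasing in `x`, `SupercriticalSAW.lawAt_setOf_lt_length_mono`, and the two phases push from both sides) — a canonical `μ`-free route to the critical point ("no closed formula exists in general" [cite: DuminilCopinKozmaYadin2014, §1]) along which the length is pinned at the critical scale with probability `t`; nothing in the catalogue constrains the limit laws along `x_δ` (they may be thin, onto or neither: the base mechanism needs a FIXED `x > x_c`, the thin mechanism needs `|γ_δ| = O(1/δ)` w.h.p.), nor decides whether `x_δ - x_c = o(δ²)` (the window in which `…Narrow` identifies the laws with the critical ones) — a planner may therefore study `P_{x_δ,δ}` as a surrogate for the critical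 law whose criticality is a theorem rather than an input
- scope_caveats: the supercritical length bound carries the logarithm of Theorem 1 (the source asserts order `δ⁻²` and Problem 9 asks for a density `θ(x)` [cite: DuminilCopinKozmaYadin2014, §4 (Problem 9)]; neither is proved here) and is proved for closest-site endpoints of boundary points of the unit disc only; the tuned theorem pins ONE quantile of the length — it excludes no type of subsequential limit along `x_δ`, and a one-parameter family cannot meet two balance conditions; the avoidance balance of `…Phases` (xi), which would force non-onto limits, lacks a proved monotonicity in `x`, so convergence of avoidance-tuned fugacities to `x_c` is NOT proved; uniqueness of `x_δ` is not claimed (strict monotonicity would need a variance argument); nothing here bears on the law at `x_c` itself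
- status: established (proved in the tree: `SupercriticalSAWSpaceFillingTuned_holds`, axioms `propext`, `Classical.choice`, `Quot.sound`); audit gen 6 of `…Proofs` 2026-08-16, part B: CONFIRMED [cite: DuminilCopinKozmaYadin2014, Theorem 1 and §4] and EXTENDED to the length axis; evasion (xi) upgraded from a remark to a theorem for the length balance

[cite: DuminilCopinKozmaYadin2014, Theorem 1 and §4] -/
def SupercriticalSAWSpaceFillingTuned : Prop :=
  SupercriticalSAWSpaceFilling ∧
    (∀ x : ℝ, criticalFugacity < x → ∀ a b : ℂ, ‖a‖ = 1 → ‖b‖ = 1 → a ≠ b → ∀ A B : ℝ → Site 2,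
      (∀ δ : ℝ, 0 < δ → IsClosestSite unitDisk δ a (A δ) ∧ IsClosestSite unitDisk δ b (B δ)) →
        ∃ κ₀ : ℝ, 0 < κ₀ ∧
          Tendsto (fun δ : ℝ => lawAt x unitDisk δ (A δ) (B δ)
            {γ | ((γ.length : ℝ) + 1) * (δ ^ 2 * Real.log (1 / δ) ^ 2) < κ₀}) (𝓝[>] 0) (𝓝 0)) ∧
    (∀ A B : ℝ → Site 2,
      (∀ δ : ℝ, 0 < δ → IsClosestSite unitDisk δ 1 (A δ) ∧ IsClosestSite unitDisk δ (-1) (B δ)) →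
        ∀ x : ℝ → ℝ,
          (∀ᶠ δ in 𝓝[>] (0 : ℝ), 0 < x δ ∧
            lawAt (x δ) unitDisk δ (A δ) (B δ) {γ | δ ^ (-(4 : ℝ) / 3) < γ.length} =
              ENNReal.ofReal (1 / 2)) →
          Tendsto x (𝓝[>] 0) (𝓝 criticalFugacity))

/-- **The audited barrier holds**: Theorem 1 is `SupercriticalSAWSpaceFilling_holds`, clause (a)
is `tendsto_lawAt_length_mul_lt_of_lt`, clause (b) is `tendsto_criticalFugacity_of_tuned_unitDisc`.
[cite: DuminilCopinKozmaYadin2014, Theorem 1 and §4] -/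
theorem SupercriticalSAWSpaceFillingTuned_holds : SupercriticalSAWSpaceFillingTuned :=
  ⟨SupercriticalSAWSpaceFilling_holds,
    fun _ hx _ _ ha hb hab _ _ hAB => tendsto_lawAt_length_mul_lt_of_lt hx ha hb hab hAB,
    fun _ _ hAB _ hx => tendsto_criticalFugacity_of_tuned_unitDisc hAB hx⟩

end Literature.Barriers.CriticalPhenomena
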